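import Literature.AlgebraicGeometry.Frobenioids.UnitTrivializationModelComparison
import HarnessLib

/-!
# Frobenioids I, Def. 4.5 (iii)(b): a Frobenius-compact object of `(C^un-tr)^birat` from ONE rational
# function with non-torsion, automorphism-invariant divisor (the argument of Thm. 6.4 (i), p. 115) — PROOFS

Mochizuki, *The geometry of Frobenioids I: the general theory*, Kyushu J. Math. **62** (2008) 293–400.
Def. 1.2 (iv) p. 23 (Frobenius-compact: "`O^×(A)` is commutative, `O^×(A)^pf ≠ 0`, and every
automorphism of `A` that acts on `O^×(A)^pf` by multiplication by some `λ ∈ ℚ_{>0}` acts trivially"),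
Def. 4.5 (iii)(b) p. 86 ("`(C^un-tr)^birat` admits a Frobenius-compact object"), and the proof of
Thm. 6.4 (i), kurims p. 115 ll. 22–23: "Moreover, by considering the effect of automorphisms of number
fields on arithmetic divisors, it follows … that every object of `(C^un-tr)^birat` is Frobenius-compact."
[cite: MochizukiFrdI2008, Thm. 6.4 (i) p.115] [cite: MochizukiFrdI2008, Def. 4.5 (iii) p.86]

PROOF-ONLY (theorems, no `def`; cell abc-iut, seat abc-iut-L6-t10 gen 3 = holder of the [FrdI] §6 sub-DAG,
row T64i/L10 "(b) a Frobenius-compact object of `(C^un-tr)^birat`"; also the engine for T62iii/L10 and for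
[FrdII] Thm. 1.2 (i) at THE `R`-datum).  The printed argument, made generic over seat abc-iut-L6-t8's
explicit units `O^×(A^birat) = BiratUnits F hF A` and their divisor homomorphism
`Div : O^×(A^birat) → Φ^gp(A_D)` (`BiratUnits.divHom`, Prop. 4.4 (i)/(iii)), seat abc-iut-w4-d020's
conjugation calculus (`BiratUnits.exists_toHom_eq_conj`, `divHom_eq_of_toHom_eq_conj`:
`Div(f⁻¹ u f) = Base(f⁻¹)^* Div(u)`), and seat abc-iut-L1-d5's description of the units of
`(A^un-tr)^birat` (`divHom_untr_injective`, `range_divHom_untr`: for `A ∈ Ob(C^un-tr)`,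
`Div : O^×(A^birat) ⥲ Φ^birat(A_D)` is an ISOMORPHISM):

* `Birat.isFrobeniusCompact_toBirat_obj_of_scaling` — for ANY Frobenioid `C` and `A ∈ Ob(C)` with
  `O^×(A^birat)` commutative: if some rational function `x₀` at `A` has NON-TORSION divisor `d₀ = Div(x₀)`
  such that, for every automorphism `f` of `A^birat`, a relation `(Base(f⁻¹)^* d₀)^{qN} = d₀^{pN}`
  (`N ≥ 1`) forces `p = q` ("the effect of automorphisms … on divisors"), then `A^birat` is
  Frobenius-compact.  [`O^×(A^birat)^pf ∋ [x₀] ≠ 0`; if `f` acts on `O^×(A^birat)^pf` by `λ = p/q` then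
  reading the relation `((f x₀ f⁻¹)^q)^N = (x₀^p)^N` through `Div` gives `p = q`, and then
  `((f u f⁻¹)^p)^N = (u^p)^N` IS `(f u f⁻¹)^{pN} = u^{pN}` for every unit `u`.]
* `Birat.isFrobeniusCompact_toBirat_obj_of_invariant` — the case `Base(f⁻¹)^* d₀ = d₀` for all `f`
  (e.g. `d₀ = div(2)` in the arithmetic Frobenioid: automorphisms of number fields fix `2`).
* `Birat.untr_isFrobeniusCompact_of_invariant` / `exists_isFrobeniusCompact_untrBirat_of_invariant` — for
  `A ∈ Ob(C^un-tr)`: commutativity of `O^×(A^birat)` is AUTOMATIC (`Div` is injective into the abelian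
  `Φ^gp`), and `x₀` is supplied by any `d₀ ∈ Φ^birat(A_D)`; so ONE non-torsion, automorphism-invariant
  element of `Φ^birat(A_D)` yields Def. 4.5 (iii)(b) for `C`.

No statement of the paper is strengthened; nothing here bears on [IUTchIII] Cor. 3.12 (L1 = [FrdI], a
refereed preparatory paper).
-/

namespace Literature.AlgebraicGeometry.Frobenioids

open CategoryTheory Opposite

universe w v v' u u'

namespace PreFrobenioid

variable {D : Type u} [Category.{v} D] {Φ : Dᵒᵖ ⥤ CommMonCat.{w}}
  {C : Type u'} [Category.{v'} C] {F : C ⥤ ElemFrobenioid Φ}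

open PreFrobenioidData (ofFunctor)

namespace Birat

/-! ### Conjugates of units of `A^birat` and their divisors -/

/-- The conjugate `f u f⁻¹` (Mathlib's `Aut`: `(f * u * f⁻¹).hom = f⁻¹ ≫ u ≫ f`) of the unit `u = [x]` of
`A^birat` along an automorphism `f` of `A^birat` is again a rational function `[y]`, with
`Div(y) = Base(f⁻¹)^* Div(x)` (seat abc-iut-w4-d020's `exists_toHom_eq_conj` + `divHom_eq_of_toHom_eq_conj`).
[cite: MochizukiFrdI2008, Prop. 4.4 (i) p.83] -/
theorem exists_biratUnits_conj (hF : IsFrobenioid F) (hsq : HasBiratSquares F) {A : C}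
    (f : Aut ((toBirat F hF hsq).obj A)) (x : BiratUnits F hF A) :
    ∃ y : BiratUnits F hF A, BiratUnits.toAut hsq y = f * BiratUnits.toAut hsq x * f⁻¹ ∧
      BiratUnits.divHom hF A y = pullGp Φ (gpBase f.inv) (BiratUnits.divHom hF A x) := by
  obtain ⟨y, hy⟩ := BiratUnits.exists_toHom_eq_conj (hsq := hsq) f x
  refine ⟨y, ?_, BiratUnits.divHom_eq_of_toHom_eq_conj hy⟩
  apply Iso.ext
  rw [BiratUnits.toAut_hom, hy, Aut.Aut_mul_def, Aut.Aut_mul_def, Aut.Aut_inv_def]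
  rfl

/-! ### The criterion -/

/-- **Frobenius-compactness of `A^birat` from one rational function** (the argument of [FrdI] Thm. 6.4 (i),
p. 115, generic): let `O^×(A^birat)` be commutative and `x₀ ∈ O^×(A^birat)` have non-torsion divisor
`d₀`; if for every automorphism `f` of `A^birat` a relation `(Base(f⁻¹)^* d₀)^{qN} = d₀^{pN}` with `N ≥ 1`
forces `p = q`, then `A^birat` is Frobenius-compact for `C^birat → F_{0_D}` (Def. 1.2 (iv)).
[cite: MochizukiFrdI2008, Thm. 6.4 (i) p.115] -/
theorem isFrobeniusCompact_toBirat_obj_of_scaling (hF : IsFrobenioid F) (hsq : HasBiratSquares F) {A : C}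
    (hcomm : ∀ x y : BiratUnits F hF A, x * y = y * x) (x₀ : BiratUnits F hF A)
    (htors : ∀ N : ℕ, 0 < N → BiratUnits.divHom hF A x₀ ^ N ≠ 1)
    (hscal : ∀ (f : Aut ((toBirat F hF hsq).obj A)) (p q N : ℕ), 0 < N →
      pullGp Φ (gpBase f.inv) (BiratUnits.divHom hF A x₀) ^ (q * N) =
        BiratUnits.divHom hF A x₀ ^ (p * N) → p = q) :
    (biratOps hF hsq).IsFrobeniusCompact ((toBirat F hF hsq).obj A) := by
  refine ⟨fun u hu u' hu' => ?_, ⟨(BiratUnits.toAut hsq x₀ : Aut _), toAut_mem_unitsSubgroup x₀,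
    fun N hN h => htors N hN ?_⟩, fun f p q hpq u hu => ?_⟩
  · -- (1) `O^×(A^birat)` is commutative
    obtain ⟨x, hx⟩ := exists_toAut_eq hsq ⟨u, hu⟩
    obtain ⟨x', hx'⟩ := exists_toAut_eq hsq ⟨u', hu'⟩
    change BiratUnits.toAut hsq x = u at hx
    change BiratUnits.toAut hsq x' = u' at hx'
    rw [← hx, ← hx', ← map_mul, hcomm, map_mul]
  · -- (2) `[x₀] ∈ O^×(A^birat)^pf` is nonzero
    have h' : x₀ ^ N = 1 := BiratUnits.toAut_injective (hsq := hsq) (by rw [map_pow, h, map_one])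
    rw [← map_pow, h', map_one]
  · -- (3) an automorphism acting by `λ = p/q` on `O^×(A^birat)^pf` acts trivially
    obtain ⟨y₀, hy₀, hdy₀⟩ := exists_biratUnits_conj hF hsq f x₀
    obtain ⟨N₀, hN₀, h₀⟩ := hpq _ (toAut_mem_unitsSubgroup x₀)
    rw [← hy₀, ← map_pow, ← map_pow, ← map_pow, ← map_pow] at h₀
    have h₀' := congrArg (BiratUnits.divHom hF A) (BiratUnits.toAut_injective h₀)
    rw [map_pow, map_pow, map_pow, map_pow, hdy₀, ← pow_mul, ← pow_mul] at h₀'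
    have hpq' : (p : ℕ) = q := hscal f p q N₀ hN₀ h₀'
    obtain ⟨N, hN, h⟩ := hpq u hu
    refine ⟨p * N, Nat.mul_pos p.pos hN, ?_⟩
    have e : ((f * u * f⁻¹) ^ (p : ℕ)) ^ N = ((f * u * f⁻¹) ^ (q : ℕ)) ^ N := by rw [hpq']
    rw [pow_mul, pow_mul, e]
    exact h

/-- **The invariant case**: if `Base(f⁻¹)^* d₀ = d₀` for every automorphism `f` of `A^birat` (in the
arithmetic Frobenioid: `d₀ = div(2)`, automorphisms of number fields fix `2`), a non-torsion `d₀ = Div(x₀)`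
with `O^×(A^birat)` commutative makes `A^birat` Frobenius-compact. [cite: MochizukiFrdI2008, Thm. 6.4 (i) p.115] -/
theorem isFrobeniusCompact_toBirat_obj_of_invariant (hF : IsFrobenioid F) (hsq : HasBiratSquares F) {A : C}
    (hcomm : ∀ x y : BiratUnits F hF A, x * y = y * x) (x₀ : BiratUnits F hF A)
    (htors : ∀ N : ℕ, 0 < N → BiratUnits.divHom hF A x₀ ^ N ≠ 1)
    (hinv : ∀ f : Aut ((toBirat F hF hsq).obj A),
      pullGp Φ (gpBase f.inv) (BiratUnits.divHom hF A x₀) = BiratUnits.divHom hF A x₀) :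
    (biratOps hF hsq).IsFrobeniusCompact ((toBirat F hF hsq).obj A) := by
  refine isFrobeniusCompact_toBirat_obj_of_scaling hF hsq hcomm x₀ htors fun f p q N hN h => ?_
  rw [hinv f] at h
  -- `d₀ ^ (q N) = d₀ ^ (p N)` with `d₀` non-torsion forces `p = q`
  have key : ∀ a b : ℕ, a < b →
      BiratUnits.divHom hF A x₀ ^ (b * N) = BiratUnits.divHom hF A x₀ ^ (a * N) → False := by
    intro a b hab he
    refine htors ((b - a) * N) (Nat.mul_pos (Nat.sub_pos_of_lt hab) hN) ?_
    rw [Nat.sub_mul, pow_sub _ (Nat.mul_le_mul_right N hab.le), he, mul_inv_cancel]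
  by_contra hne
  rcases Nat.lt_or_gt_of_ne hne with hlt | hgt
  · exact key p q hlt h
  · exact key q p hgt h.symm

/-! ### `(C^un-tr)^birat`: one non-torsion invariant element of `Φ^birat(A_D)` suffices -/

/-- **Def. 4.5 (iii)(b) at an object of `C^un-tr`**: for a Frobenioid `C` and `A ∈ Ob(C^un-tr)` over
`A_D`, a NON-TORSION element `d₀ ∈ Φ^birat(A_D)` fixed by `Base(f⁻¹)^*` for every automorphism `f` of
`A^birat` makes `A^birat ∈ Ob((C^un-tr)^birat)` Frobenius-compact: `O^×(A^birat) ⥲ Φ^birat(A_D)` by `Div`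
(seat abc-iut-L1-d5's `divHom_untr_injective` / `range_divHom_untr`), so `O^×(A^birat)` is abelian and
`d₀ = Div(x₀)`. [cite: MochizukiFrdI2008, Def. 4.5 (iii) p.86] -/
theorem untr_isFrobeniusCompact_of_invariant (hF : IsFrobenioid F) (A : (ofFunctor Φ F).Untr)
    (d₀ : PhiGp (untrFunctor hF) A) (hd₀ : d₀ ∈ biratSubgroup F (baseObj (untrFunctor hF) A))
    (htors : ∀ N : ℕ, 0 < N → d₀ ^ N ≠ 1)
    (hinv : ∀ f : Aut ((toBirat (untrFunctor hF) (isFrobenioid_untr hF) (hasBiratSquares_untr hF)).obj A),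
      pullGp Φ (gpBase f.inv) d₀ = d₀) :
    (biratOps (isFrobenioid_untr hF) (hasBiratSquares_untr hF)).IsFrobeniusCompact
      ((toBirat (untrFunctor hF) (isFrobenioid_untr hF) (hasBiratSquares_untr hF)).obj A) := by
  obtain ⟨x₀, rfl⟩ : d₀ ∈ (BiratUnits.divHom (isFrobenioid_untr hF) A).range := by
    rw [range_divHom_untr]; exact hd₀
  have hcomm : ∀ x y : BiratUnits (untrFunctor hF) (isFrobenioid_untr hF) A, x * y = y * x :=
    fun x y => divHom_untr_injective hF A (by rw [map_mul, map_mul, mul_comm])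
  exact isFrobeniusCompact_toBirat_obj_of_invariant _ _ hcomm x₀ htors hinv

/-- **Def. 4.5 (iii)(b) for `C`, existence form**: if SOME object `A ∈ Ob(C^un-tr)` carries a non-torsion
element `d₀ ∈ Φ^birat(A_D)` invariant under the base maps of the automorphisms of `A^birat`, then
`(C^un-tr)^birat` admits a Frobenius-compact object (THE `R`-datum `BU :=` the birationalization of
`C^un-tr`). [cite: MochizukiFrdI2008, Def. 4.5 (iii) p.86] -/
theorem exists_isFrobeniusCompact_untrBirat_of_invariant (hF : IsFrobenioid F) (A : (ofFunctor Φ F).Untr)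
    (d₀ : PhiGp (untrFunctor hF) A) (hd₀ : d₀ ∈ biratSubgroup F (baseObj (untrFunctor hF) A))
    (htors : ∀ N : ℕ, 0 < N → d₀ ^ N ≠ 1)
    (hinv : ∀ f : Aut ((toBirat (untrFunctor hF) (isFrobenioid_untr hF) (hasBiratSquares_untr hF)).obj A),
      pullGp Φ (gpBase f.inv) d₀ = d₀) :
    ∃ Y : Birat (untrFunctor hF) (isFrobenioid_untr hF) (hasBiratSquares_untr hF),
      (biratOps (isFrobenioid_untr hF) (hasBiratSquares_untr hF)).IsFrobeniusCompact Y :=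
  ⟨_, untr_isFrobeniusCompact_of_invariant hF A d₀ hd₀ htors hinv⟩

end Birat

end PreFrobenioid

end Literature.AlgebraicGeometry.Frobenioids
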